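import Literature.AnabelianGeometry.SemiGraphs.TwistedCovering
import Literature.AnabelianGeometry.SemiGraphs.GraphOfAnabelioidsGalois
import Literature.AnabelianGeometry.SemiGraphs.SemiGraphLocal
import HarnessLib

/-!
# The level chain of the twisted object over `ℍ` ([SemiAnbd] Prop. 2.6, p. 29)

Mochizuki, *Semi-graphs of anabelioids*, Publ. RIMS **42** (2006), proof of Proposition 2.6, p. 29
[cite: MochizukiSemiAnbd2006, Prop. 2.6 p.29] ("since `e_a, e_b` are coverticial, [the cyclic
covering] is connected over `ℍ`"), for the downstairs twisted object `Z_M = twistedObj A b₀ T₁ M`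
(`TwistedCovering.lean`): if the components `T₁ ≠ T₂ ⊆ A_e` are glued at the two branches of `e`
into components `S₀ ⊆ A_{v₀}`, `S₁ ⊆ A_{v₁}` (the shadow in `A` of a coverticial pair over `e`), then
a subobject `W ↪ Z_M|_ℍ` containing the level-`0` copy of `S₀` contains all its levels — the loop
`S₀ →[b₀, twisted] T₁ →[b₁] S₁ →[x] T₂ →[y] S₀` raises the level by one (`levE_of_levV`,
`levV_of_levE`, `levV_all`, stated over the constituent categories of `𝒢`).  Consequently, in the
Galois category `B(𝒢_ℍ)` (abc-iut-L3-t9) all `M` levels over a point of `S₀` lie in ONE `Π_ℍ`-orbit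
(`twistedObj_levels_mem_orbit`).  Proof-only (abc-iut-L6-t18, sub-node P26-R).
-/

namespace Literature.AnabelianGeometry.SemiGraphs

open CategoryTheory CategoryTheory.Limits CategoryTheory.PreGaloisCategory
open Literature.AnabelianGeometry.Anabelioids

universe w v₁ u₁ u

namespace TwistedCovering

/-- The twist is trivial on the other components: for connected components `T₁ ≠ T₂` of `X`,
`T₂ ↪ X ↪ ∐ X` is unchanged by the twist along `T₁`. [cite: MochizukiSemiAnbd2006, Prop. 2.6 p.29] -/
theorem arrow_ι_twistAut_hom_of_ne {C : Type u₁} [Category.{v₁} C] [GaloisCategory C] {X : C}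
    (T₁ T₂ : π₀Obj X) (hT : T₁ ≠ T₂) (M : ℕ) [NeZero M] (i : ZMod M) :
    T₂.1.arrow ≫ Sigma.ι (fun _ : ZMod M => X) i ≫ (twistAut T₁.1.arrow M).hom =
      T₂.1.arrow ≫ Sigma.ι (fun _ : ZMod M => X) i := by
  classical
  haveI : PreGaloisCategory.IsConnected (T₁.1 : C) := T₁.2
  haveI : PreGaloisCategory.IsConnected (T₂.1 : C) := T₂.2
  let F := GaloisCategory.getFiberFunctor C
  obtain ⟨t⟩ := (inferInstance : Nonempty (F.obj (T₂.1 : C)))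
  -- the point `T₂.arrow t` of `F X` lies in the summand `T₁` or in its complement
  obtain ⟨⟨j⟩, y, hy⟩ := Concrete.isColimit_exists_rep (pair (T₁.1 : C) (complObj T₁.1.arrow) ⋙ F)
    (isColimitOfPreserves F (complIsColimit T₁.1.arrow)) (F.map T₂.1.arrow t)
  rcases j with _ | _
  · -- in `T₁`: then `T₁ = T₂`
    exact absurd (component_eq_of_mem_range F T₁ T₂ ⟨y, hy⟩ ⟨t, rfl⟩) hT
  · -- in the complement: `T₂.arrow` factors through it
    haveI : Mono (complHom T₁.1.arrow) :=
      MonoCoprod.binaryCofan_inr _ (complIsColimit T₁.1.arrow)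
    obtain ⟨g, hg⟩ := exists_lift_of_mono F T₂.2 (complHom T₁.1.arrow) inferInstance T₂.1.arrow t y hy
    rw [← hg, Category.assoc, Category.assoc]
    erw [compl_ι_twistMap]

end TwistedCovering

namespace SemiGraphOfAnabelioids

variable (𝒢 : SemiGraphOfAnabelioids.{v₁, u₁, u}) (A : 𝒢.BObj) (b₀ : 𝒢.graph.Branch)
  {Q : 𝒢.E (𝒢.graph.edgeOf b₀)} (q : Q ⟶ A.T (𝒢.graph.edgeOf b₀)) [Mono q] (M : ℕ) [NeZero M]

/-- The fibre computation behind both chain steps: through the gluing of `Z_M` at `c`, the level-`i`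
copy of `c^* P` meets the level-`σ i` copy of `R`. [cite: MochizukiSemiAnbd2006, Prop. 2.6 p.29] -/
theorem map_glue_level (c : 𝒢.graph.Branch) (v : 𝒢.graph.Vertex) (h : 𝒢.graph.abuts c = some v)
    (P : π₀Obj (A.S v)) (R : π₀Obj (A.T (𝒢.graph.edgeOf c))) (σ : ZMod M → ZMod M)
    (htw : ∀ i, R.1.arrow ≫ Sigma.ι (fun _ : ZMod M => A.T (𝒢.graph.edgeOf c)) i ≫
      (𝒢.twistFam A b₀ q M c).hom = R.1.arrow ≫ Sigma.ι (fun _ : ZMod M => A.T _) (σ i))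
    (Fe : 𝒢.E (𝒢.graph.edgeOf c) ⥤ FintypeCat.{w}) (i : ZMod M)
    (p : Fe.obj ((𝒢.pull c v h).pullback.obj (P.1 : 𝒢.V v))) (r : Fe.obj (R.1 : 𝒢.E _))
    (hp : Fe.map ((𝒢.pull c v h).pullback.map P.1.arrow ≫ (A.ψ c v h).hom) p = Fe.map R.1.arrow r) :
    Fe.map ((𝒢.pull c v h).pullback.map (P.1.arrow ≫ Sigma.ι (fun _ : ZMod M => A.S v) i) ≫
        ((𝒢.twistedObj A b₀ q M).ψ c v h).hom) p =
      Fe.map (R.1.arrow ≫ Sigma.ι (fun _ : ZMod M => A.T _) (σ i)) r := by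
  rw [(𝒢.pull c v h).pullback.map_comp, Category.assoc, map_ι_twistedObj_ψ_hom, ← htw i]
  simp only [Fe.map_comp, FintypeCat.comp_apply] at hp ⊢
  rw [hp]

/-- **Chain step, vertex to edge**: for a subobject `W ↪ Z_M` given by constituents `W_v ↪ (Z_M)_v`,
`W_e ↪ (Z_M)_e` compatible with the gluing at `c`: if the level-`i` copy of the vertex piece
`P ⊆ S_v` lies in `W_v`, the level-`σ i` copy of an edge piece `R ⊆ T_e` glued into `P` at `c` lies
in `W_e`. [cite: MochizukiSemiAnbd2006, Prop. 2.6 p.29] -/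
theorem levE_of_levV (c : 𝒢.graph.Branch) (v : 𝒢.graph.Vertex) (h : 𝒢.graph.abuts c = some v)
    {WS : 𝒢.V v} {WT : 𝒢.E (𝒢.graph.edgeOf c)} (mS : WS ⟶ (𝒢.twistedObj A b₀ q M).S v)
    (mT : WT ⟶ (𝒢.twistedObj A b₀ q M).T (𝒢.graph.edgeOf c)) (hmT : Mono mT)
    (eW : (𝒢.pull c v h).pullback.obj WS ≅ WT)
    (hcomm : (𝒢.pull c v h).pullback.map mS ≫ ((𝒢.twistedObj A b₀ q M).ψ c v h).hom = eW.hom ≫ mT)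
    (P : π₀Obj (A.S v)) (R : π₀Obj (A.T (𝒢.graph.edgeOf c))) (σ : ZMod M → ZMod M)
    (htw : ∀ i, R.1.arrow ≫ Sigma.ι (fun _ : ZMod M => A.T (𝒢.graph.edgeOf c)) i ≫
      (𝒢.twistFam A b₀ q M c).hom = R.1.arrow ≫ Sigma.ι (fun _ : ZMod M => A.T _) (σ i))
    (hgl : ∀ (Fe : 𝒢.E (𝒢.graph.edgeOf c) ⥤ FintypeCat.{v₁}) [FiberFunctor Fe],
      Set.range (Fe.map R.1.arrow) ⊆
        Set.range (Fe.map ((𝒢.pull c v h).pullback.map P.1.arrow ≫ (A.ψ c v h).hom)))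
    (i : ZMod M)
    (hP : ∃ g : (P.1 : 𝒢.V v) ⟶ WS, g ≫ mS = P.1.arrow ≫ Sigma.ι (fun _ : ZMod M => A.S v) i) :
    ∃ g : (R.1 : 𝒢.E _) ⟶ WT, g ≫ mT = R.1.arrow ≫ Sigma.ι (fun _ : ZMod M => A.T _) (σ i) := by
  classical
  obtain ⟨g, hg⟩ := hP
  haveI : PreGaloisCategory.IsConnected (R.1 : 𝒢.E (𝒢.graph.edgeOf c)) := R.2
  let Fe := GaloisCategory.getFiberFunctor (𝒢.E (𝒢.graph.edgeOf c))
  obtain ⟨r⟩ := (inferInstance : Nonempty (Fe.obj (R.1 : 𝒢.E (𝒢.graph.edgeOf c))))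
  obtain ⟨p, hp⟩ := hgl Fe ⟨r, rfl⟩
  have hc1 := congrArg (fun k => Fe.map k (Fe.map ((𝒢.pull c v h).pullback.map g) p)) hcomm
  have hg1 := congrArg (fun k => Fe.map ((𝒢.pull c v h).pullback.map k ≫
    ((𝒢.twistedObj A b₀ q M).ψ c v h).hom) p) hg
  have hm1 := 𝒢.map_glue_level A b₀ q M c v h P R σ htw Fe i p r hp
  simp only [] at hc1 hg1
  rw [(𝒢.pull c v h).pullback.map_comp g] at hg1
  simp only [Fe.map_comp, FintypeCat.comp_apply] at hc1 hg1 hm1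
  exact TwistedCovering.exists_lift_of_mono Fe R.2 mT hmT _ r
    (Fe.map eW.hom (Fe.map ((𝒢.pull c v h).pullback.map g) p)) (by
      rw [Fe.map_comp, FintypeCat.comp_apply]
      exact hc1.symm.trans (hg1.trans hm1))

/-- **Chain step, edge to vertex**: conversely, if the level-`σ i` copy of the edge piece `R` (glued
into `P` at `c`) lies in `W_e`, the level-`i` copy of `P` lies in `W_v`. [cite: MochizukiSemiAnbd2006, Prop. 2.6 p.29] -/
theorem levV_of_levE (c : 𝒢.graph.Branch) (v : 𝒢.graph.Vertex) (h : 𝒢.graph.abuts c = some v)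
    {WS : 𝒢.V v} {WT : 𝒢.E (𝒢.graph.edgeOf c)} (mS : WS ⟶ (𝒢.twistedObj A b₀ q M).S v)
    (hmS : Mono mS) (mT : WT ⟶ (𝒢.twistedObj A b₀ q M).T (𝒢.graph.edgeOf c))
    (eW : (𝒢.pull c v h).pullback.obj WS ≅ WT)
    (hcomm : (𝒢.pull c v h).pullback.map mS ≫ ((𝒢.twistedObj A b₀ q M).ψ c v h).hom = eW.hom ≫ mT)
    (P : π₀Obj (A.S v)) (R : π₀Obj (A.T (𝒢.graph.edgeOf c))) (σ : ZMod M → ZMod M)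
    (htw : ∀ i, R.1.arrow ≫ Sigma.ι (fun _ : ZMod M => A.T (𝒢.graph.edgeOf c)) i ≫
      (𝒢.twistFam A b₀ q M c).hom = R.1.arrow ≫ Sigma.ι (fun _ : ZMod M => A.T _) (σ i))
    (hgl : ∀ (Fe : 𝒢.E (𝒢.graph.edgeOf c) ⥤ FintypeCat.{v₁}) [FiberFunctor Fe],
      Set.range (Fe.map R.1.arrow) ⊆
        Set.range (Fe.map ((𝒢.pull c v h).pullback.map P.1.arrow ≫ (A.ψ c v h).hom)))
    (i : ZMod M)
    (hR : ∃ g : (R.1 : 𝒢.E _) ⟶ WT, g ≫ mT = R.1.arrow ≫ Sigma.ι (fun _ : ZMod M => A.T _) (σ i)) :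
    ∃ g : (P.1 : 𝒢.V v) ⟶ WS, g ≫ mS = P.1.arrow ≫ Sigma.ι (fun _ : ZMod M => A.S v) i := by
  classical
  obtain ⟨g', hg'⟩ := hR
  haveI : PreGaloisCategory.IsConnected (R.1 : 𝒢.E (𝒢.graph.edgeOf c)) := R.2
  let Fe := GaloisCategory.getFiberFunctor (𝒢.E (𝒢.graph.edgeOf c))
  let Φ : 𝒢.V v ⥤ FintypeCat.{v₁} := (𝒢.pull c v h).pullback ⋙ Fe
  haveI : FiberFunctor Φ := fiberFunctor_comp_of_exact _ _
  obtain ⟨r⟩ := (inferInstance : Nonempty (Fe.obj (R.1 : 𝒢.E (𝒢.graph.edgeOf c))))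
  obtain ⟨p, hp⟩ := hgl Fe ⟨r, rfl⟩
  have hinj : Function.Injective (Fe.map ((𝒢.twistedObj A b₀ q M).ψ c v h).hom) :=
    (FintypeCat.equivEquivIso.symm (Fe.mapIso ((𝒢.twistedObj A b₀ q M).ψ c v h))).injective
  have hinv : ∀ y, Fe.map eW.hom (Fe.map eW.inv y) = y := fun y => by
    rw [← FintypeCat.comp_apply, ← Fe.map_comp, Iso.inv_hom_id, Fe.map_id, FintypeCat.id_apply]
  have hc2 := congrArg (fun k => Fe.map k (Fe.map eW.inv (Fe.map g' r))) hcomm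
  have hg2 := congrArg (fun k => Fe.map k r) hg'
  have hm2 := 𝒢.map_glue_level A b₀ q M c v h P R σ htw Fe i p r hp
  simp only [] at hc2 hg2
  simp only [Fe.map_comp, FintypeCat.comp_apply] at hc2 hg2 hm2
  rw [hinv] at hc2
  have key : Φ.map mS (Fe.map eW.inv (Fe.map g' r)) =
      Φ.map (P.1.arrow ≫ Sigma.ι (fun _ : ZMod M => A.S v) i) p := by
    apply hinj
    exact (hc2.trans hg2).trans hm2.symm
  exact TwistedCovering.exists_lift_of_mono Φ P.2 mS hmS _ p _ key

end SemiGraphOfAnabelioids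

end Literature.AnabelianGeometry.SemiGraphs

namespace Literature.AnabelianGeometry.SemiGraphs

open CategoryTheory CategoryTheory.Limits CategoryTheory.PreGaloisCategory
open Literature.AnabelianGeometry.Anabelioids

universe w v₁ u₁ u

namespace SemiGraphOfAnabelioids

variable (𝒢 : SemiGraphOfAnabelioids.{v₁, u₁, u}) (A : 𝒢.BObj) (b₀ : 𝒢.graph.Branch)
  (T₁ : π₀Obj (A.T (𝒢.graph.edgeOf b₀))) (M : ℕ) [NeZero M] (H : 𝒢.graph.Subgraph)

/-- Transport of the edge-level membership statement along an equality of edges. [cite: MochizukiSemiAnbd2006, Prop. 2.6 p.29] -/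
theorem levE_cast (WT : ∀ e : 𝒢.graph.Edge, e ∈ H.edges → 𝒢.E e)
    (mT : ∀ (e : 𝒢.graph.Edge) (he : e ∈ H.edges),
      WT e he ⟶ (𝒢.twistedObj A b₀ T₁.1.arrow M).T e)
    {e e' : 𝒢.graph.Edge} (h : e' = e) (he : e ∈ H.edges) (he' : e' ∈ H.edges)
    (R : π₀Obj (A.T e)) (j : ZMod M) :
    (∃ g : ((h ▸ R : π₀Obj (A.T e')).1 : 𝒢.E e') ⟶ WT e' he',
      g ≫ mT e' he' = (h ▸ R : π₀Obj (A.T e')).1.arrow ≫ Sigma.ι (fun _ : ZMod M => A.T e') j) ↔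
    (∃ g : (R.1 : 𝒢.E e) ⟶ WT e he,
      g ≫ mT e he = R.1.arrow ≫ Sigma.ι (fun _ : ZMod M => A.T e) j) := by
  subst h
  rfl

/-- **The level chain** ([SemiAnbd] p. 29, "since `e_a, e_b` are coverticial …"): for a subobject
`W` of the twisted object (given constituentwise, compatibly with the gluings) containing the
level-`0` copy of the vertex piece `S₀`, the loop `S₀ →[b₀, twisted] T₁ →[b₁] S₁ →[x] T₂ →[y] S₀`
raises the level by one, so `W` contains every level of `S₀`. [cite: MochizukiSemiAnbd2006, Prop. 2.6 p.29] -/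
theorem levV_all (T₂ : π₀Obj (A.T (𝒢.graph.edgeOf b₀)))
    (v₀ v₁ : 𝒢.graph.Vertex) (h₀ : 𝒢.graph.abuts b₀ = some v₀)
    (b₁ : 𝒢.graph.Branch) (hb₁ : 𝒢.graph.edgeOf b₁ = 𝒢.graph.edgeOf b₀) (hne : b₁ ≠ b₀)
    (h₁ : 𝒢.graph.abuts b₁ = some v₁)
    (x y : 𝒢.graph.Branch) (hx : 𝒢.graph.edgeOf x = 𝒢.graph.edgeOf b₀)
    (hy : 𝒢.graph.edgeOf y = 𝒢.graph.edgeOf b₀)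
    (hxv : 𝒢.graph.abuts x = some v₁) (hyv : 𝒢.graph.abuts y = some v₀)
    (S₀ : π₀Obj (A.S v₀)) (S₁ : π₀Obj (A.S v₁))
    (g₀ : ∀ (Fe : 𝒢.E (𝒢.graph.edgeOf b₀) ⥤ FintypeCat.{v₁}) [FiberFunctor Fe],
      Set.range (Fe.map T₁.1.arrow) ⊆
        Set.range (Fe.map ((𝒢.pull b₀ v₀ h₀).pullback.map S₀.1.arrow ≫ (A.ψ b₀ v₀ h₀).hom)))
    (g₁ : ∀ (Fe : 𝒢.E (𝒢.graph.edgeOf b₁) ⥤ FintypeCat.{v₁}) [FiberFunctor Fe],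
      Set.range (Fe.map (hb₁ ▸ T₁ : π₀Obj (A.T (𝒢.graph.edgeOf b₁))).1.arrow) ⊆
        Set.range (Fe.map ((𝒢.pull b₁ v₁ h₁).pullback.map S₁.1.arrow ≫ (A.ψ b₁ v₁ h₁).hom)))
    (g₂ : ∀ (Fe : 𝒢.E (𝒢.graph.edgeOf x) ⥤ FintypeCat.{v₁}) [FiberFunctor Fe],
      Set.range (Fe.map (hx ▸ T₂ : π₀Obj (A.T (𝒢.graph.edgeOf x))).1.arrow) ⊆
        Set.range (Fe.map ((𝒢.pull x v₁ hxv).pullback.map S₁.1.arrow ≫ (A.ψ x v₁ hxv).hom)))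
    (g₃ : ∀ (Fe : 𝒢.E (𝒢.graph.edgeOf y) ⥤ FintypeCat.{v₁}) [FiberFunctor Fe],
      Set.range (Fe.map (hy ▸ T₂ : π₀Obj (A.T (𝒢.graph.edgeOf y))).1.arrow) ⊆
        Set.range (Fe.map ((𝒢.pull y v₀ hyv).pullback.map S₀.1.arrow ≫ (A.ψ y v₀ hyv).hom)))
    (tx : ∀ i, (hx ▸ T₂ : π₀Obj (A.T (𝒢.graph.edgeOf x))).1.arrow ≫
      Sigma.ι (fun _ : ZMod M => A.T (𝒢.graph.edgeOf x)) i ≫ (𝒢.twistFam A b₀ T₁.1.arrow M x).hom =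
      (hx ▸ T₂ : π₀Obj (A.T (𝒢.graph.edgeOf x))).1.arrow ≫ Sigma.ι (fun _ : ZMod M => A.T _) (id i))
    (ty : ∀ i, (hy ▸ T₂ : π₀Obj (A.T (𝒢.graph.edgeOf y))).1.arrow ≫
      Sigma.ι (fun _ : ZMod M => A.T (𝒢.graph.edgeOf y)) i ≫ (𝒢.twistFam A b₀ T₁.1.arrow M y).hom =
      (hy ▸ T₂ : π₀Obj (A.T (𝒢.graph.edgeOf y))).1.arrow ≫ Sigma.ι (fun _ : ZMod M => A.T _) (id i))
    (WS : ∀ v : 𝒢.graph.Vertex, v ∈ H.verts → 𝒢.V v)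
    (mS : ∀ (v : 𝒢.graph.Vertex) (hv : v ∈ H.verts),
      WS v hv ⟶ (𝒢.twistedObj A b₀ T₁.1.arrow M).S v)
    (hmS : ∀ v hv, Mono (mS v hv))
    (WT : ∀ e : 𝒢.graph.Edge, e ∈ H.edges → 𝒢.E e)
    (mT : ∀ (e : 𝒢.graph.Edge) (he : e ∈ H.edges),
      WT e he ⟶ (𝒢.twistedObj A b₀ T₁.1.arrow M).T e)
    (hmT : ∀ e he, Mono (mT e he))
    (glueW : ∀ (c : 𝒢.graph.Branch) (v : 𝒢.graph.Vertex) (h : 𝒢.graph.abuts c = some v)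
      (hv : v ∈ H.verts) (hc : 𝒢.graph.edgeOf c ∈ H.edges),
      ∃ eW : (𝒢.pull c v h).pullback.obj (WS v hv) ≅ WT (𝒢.graph.edgeOf c) hc,
        (𝒢.pull c v h).pullback.map (mS v hv) ≫ ((𝒢.twistedObj A b₀ T₁.1.arrow M).ψ c v h).hom =
          eW.hom ≫ mT (𝒢.graph.edgeOf c) hc)
    (hv₀ : v₀ ∈ H.verts) (hv₁ : v₁ ∈ H.verts) (he : 𝒢.graph.edgeOf b₀ ∈ H.edges)
    (hS : ∃ g : (S₀.1 : 𝒢.V v₀) ⟶ WS v₀ hv₀,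
      g ≫ mS v₀ hv₀ = S₀.1.arrow ≫ Sigma.ι (fun _ : ZMod M => A.S v₀) 0)
    (i : ZMod M) :
    ∃ g : (S₀.1 : 𝒢.V v₀) ⟶ WS v₀ hv₀,
      g ≫ mS v₀ hv₀ = S₀.1.arrow ≫ Sigma.ι (fun _ : ZMod M => A.S v₀) i := by
  classical
  have he₁ : 𝒢.graph.edgeOf b₁ ∈ H.edges := hb₁ ▸ he
  have hex : 𝒢.graph.edgeOf x ∈ H.edges := hx ▸ he
  have hey : 𝒢.graph.edgeOf y ∈ H.edges := hy ▸ he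
  -- the twist on `T₁` at `b₀`; no twist at `b₁`
  have t₀ : ∀ i, T₁.1.arrow ≫ Sigma.ι (fun _ : ZMod M => A.T (𝒢.graph.edgeOf b₀)) i ≫
      (𝒢.twistFam A b₀ T₁.1.arrow M b₀).hom =
      T₁.1.arrow ≫ Sigma.ι (fun _ : ZMod M => A.T _) (i + 1) := by
    intro i
    rw [twistFam_self]
    exact TwistedCovering.t_ι_twistMap T₁.1.arrow M 1 i
  have t₁ : ∀ i, (hb₁ ▸ T₁ : π₀Obj (A.T (𝒢.graph.edgeOf b₁))).1.arrow ≫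
      Sigma.ι (fun _ : ZMod M => A.T (𝒢.graph.edgeOf b₁)) i ≫ (𝒢.twistFam A b₀ T₁.1.arrow M b₁).hom =
      (hb₁ ▸ T₁ : π₀Obj (A.T (𝒢.graph.edgeOf b₁))).1.arrow ≫ Sigma.ι (fun _ : ZMod M => A.T _) (id i) := by
    intro i
    rw [𝒢.twistFam_of_ne A b₀ T₁.1.arrow M hne, Iso.refl_hom, Category.comp_id]
    rfl
  obtain ⟨eW₀, hc₀⟩ := glueW b₀ v₀ h₀ hv₀ he
  obtain ⟨eW₁, hc₁⟩ := glueW b₁ v₁ h₁ hv₁ he₁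
  obtain ⟨eWx, hcx⟩ := glueW x v₁ hxv hv₁ hex
  obtain ⟨eWy, hcy⟩ := glueW y v₀ hyv hv₀ hey
  -- induction over the levels
  suffices hnat : ∀ n : ℕ, ∃ g : (S₀.1 : 𝒢.V v₀) ⟶ WS v₀ hv₀,
      g ≫ mS v₀ hv₀ = S₀.1.arrow ≫ Sigma.ι (fun _ : ZMod M => A.S v₀) (n : ZMod M) by
    have := hnat i.val
    rwa [ZMod.natCast_zmod_val] at this
  intro n
  induction n with
  | zero => rwa [Nat.cast_zero]
  | succ n ih =>
    rw [Nat.cast_succ]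
    -- `S₀ × {n} ⊆ W` ⟹ `T₁ × {n+1} ⊆ W` (twisted branch `b₀`)
    have L1 := 𝒢.levE_of_levV A b₀ T₁.1.arrow M b₀ v₀ h₀ (mS v₀ hv₀) (mT _ he) (hmT _ he) eW₀ hc₀
      S₀ T₁ (· + 1) t₀ g₀ (n : ZMod M) ih
    -- ⟹ `S₁ × {n+1} ⊆ W` (branch `b₁`)
    have L1' := (𝒢.levE_cast A b₀ T₁ M H WT mT hb₁ he he₁ T₁ ((n : ZMod M) + 1)).mpr L1
    have L2 := 𝒢.levV_of_levE A b₀ T₁.1.arrow M b₁ v₁ h₁ (mS v₁ hv₁) (hmS v₁ hv₁) (mT _ he₁) eW₁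
      hc₁ S₁ (hb₁ ▸ T₁) id t₁ g₁ ((n : ZMod M) + 1) L1'
    -- ⟹ `T₂ × {n+1} ⊆ W` (branch `x`)
    have L3 := 𝒢.levE_of_levV A b₀ T₁.1.arrow M x v₁ hxv (mS v₁ hv₁) (mT _ hex) (hmT _ hex) eWx
      hcx S₁ (hx ▸ T₂) id tx g₂ ((n : ZMod M) + 1) L2
    -- ⟹ `S₀ × {n+1} ⊆ W` (branch `y`)
    have L3' := (𝒢.levE_cast A b₀ T₁ M H WT mT hy he hey T₂ ((n : ZMod M) + 1)).mpr
      ((𝒢.levE_cast A b₀ T₁ M H WT mT hx he hex T₂ ((n : ZMod M) + 1)).mp L3)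
    exact 𝒢.levV_of_levE A b₀ T₁.1.arrow M y v₀ hyv (mS v₀ hv₀) (hmS v₀ hv₀) (mT _ hey) eWy
      hcy S₀ (hy ▸ T₂) id ty g₃ ((n : ZMod M) + 1) L3'

/-- **ℍ-side of the descent** ([SemiAnbd] Prop. 2.6, p. 29: over `ℍ` the twisted object has a
component with at least `M` sheets): in the Galois category `B(𝒢_ℍ)` with the basepoint through
`v₀`, all `M` levels over a point `a₀` of the vertex piece `S₀` lie in ONE `Π_ℍ`-orbit of the fibre
of `Z_M`. Hypotheses: the pieces `T₁ ≠ T₂ ⊆ T_e`, `S₀ ⊆ S_{v₀}`, `S₁ ⊆ S_{v₁}` with `T₁` glued into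
`S₀` at `b₀` and into `S₁` at the other branch `b₁` of `e`, and `T₂` glued into `S₁`, `S₀` at
branches `x`, `y` of `e`; `e ∈ ℍ`, `v₀, v₁ ∈ ℍ`, `ℍ` connected. [cite: MochizukiSemiAnbd2006, Prop. 2.6 p.29] -/
theorem twistedObj_levels_mem_orbit (hH : H.toSemiGraph.IsConnected)
    (T₂ : π₀Obj (A.T (𝒢.graph.edgeOf b₀))) (hT : T₁ ≠ T₂)
    (v₀ v₁ : 𝒢.graph.Vertex) (h₀ : 𝒢.graph.abuts b₀ = some v₀)
    (b₁ : 𝒢.graph.Branch) (hb₁ : 𝒢.graph.edgeOf b₁ = 𝒢.graph.edgeOf b₀) (hne : b₁ ≠ b₀)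
    (h₁ : 𝒢.graph.abuts b₁ = some v₁)
    (x y : 𝒢.graph.Branch) (hx : 𝒢.graph.edgeOf x = 𝒢.graph.edgeOf b₀)
    (hy : 𝒢.graph.edgeOf y = 𝒢.graph.edgeOf b₀)
    (hxv : 𝒢.graph.abuts x = some v₁) (hyv : 𝒢.graph.abuts y = some v₀)
    (S₀ : π₀Obj (A.S v₀)) (S₁ : π₀Obj (A.S v₁))
    (g₀ : ∀ (Fe : 𝒢.E (𝒢.graph.edgeOf b₀) ⥤ FintypeCat.{v₁}) [FiberFunctor Fe],
      Set.range (Fe.map T₁.1.arrow) ⊆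
        Set.range (Fe.map ((𝒢.pull b₀ v₀ h₀).pullback.map S₀.1.arrow ≫ (A.ψ b₀ v₀ h₀).hom)))
    (g₁ : ∀ (Fe : 𝒢.E (𝒢.graph.edgeOf b₁) ⥤ FintypeCat.{v₁}) [FiberFunctor Fe],
      Set.range (Fe.map (hb₁ ▸ T₁ : π₀Obj (A.T (𝒢.graph.edgeOf b₁))).1.arrow) ⊆
        Set.range (Fe.map ((𝒢.pull b₁ v₁ h₁).pullback.map S₁.1.arrow ≫ (A.ψ b₁ v₁ h₁).hom)))
    (g₂ : ∀ (Fe : 𝒢.E (𝒢.graph.edgeOf x) ⥤ FintypeCat.{v₁}) [FiberFunctor Fe],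
      Set.range (Fe.map (hx ▸ T₂ : π₀Obj (A.T (𝒢.graph.edgeOf x))).1.arrow) ⊆
        Set.range (Fe.map ((𝒢.pull x v₁ hxv).pullback.map S₁.1.arrow ≫ (A.ψ x v₁ hxv).hom)))
    (g₃ : ∀ (Fe : 𝒢.E (𝒢.graph.edgeOf y) ⥤ FintypeCat.{v₁}) [FiberFunctor Fe],
      Set.range (Fe.map (hy ▸ T₂ : π₀Obj (A.T (𝒢.graph.edgeOf y))).1.arrow) ⊆
        Set.range (Fe.map ((𝒢.pull y v₀ hyv).pullback.map S₀.1.arrow ≫ (A.ψ y v₀ hyv).hom)))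
    (hv₀ : v₀ ∈ H.verts) (hv₁ : v₁ ∈ H.verts) (he : 𝒢.graph.edgeOf b₀ ∈ H.edges)
    (F₀ : 𝒢.V v₀ ⥤ FintypeCat.{v₁}) [FiberFunctor F₀] :
    ∃ a₀ : F₀.obj (A.S v₀), ∀ i : ZMod M, ∃ σ : (𝒢.restrict H).Pi ⟨v₀, hv₀⟩ F₀,
      σ.hom.app ((𝒢.restrictFunctor H).obj (𝒢.twistedObj A b₀ T₁.1.arrow M))
          (F₀.map (Sigma.ι (fun _ : ZMod M => A.S v₀) 0) a₀) =
        F₀.map (Sigma.ι (fun _ : ZMod M => A.S v₀) i) a₀ := by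
  classical
  -- the Galois category `B(𝒢_ℍ)` and its basepoint through `v₀`
  letI := (𝒢.restrict H).preGaloisCategory_bObj
  haveI := (𝒢.restrict H).galoisCategory_bObj ⟨hH⟩
  haveI : @FiberFunctor ((𝒢.restrict H).V ⟨v₀, hv₀⟩) ((𝒢.restrict H).catV ⟨v₀, hv₀⟩)
      ((𝒢.restrict H).galV ⟨v₀, hv₀⟩).toPreGaloisCategory F₀ := ‹FiberFunctor F₀›
  haveI : FiberFunctor ((𝒢.restrict H).ρ ⟨v₀, hv₀⟩ ⋙ F₀) :=
    (𝒢.restrict H).fiberFunctor_ρ ⟨hH⟩ ⟨v₀, hv₀⟩ F₀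
  haveI : PreGaloisCategory.IsConnected (S₀.1 : 𝒢.V v₀) := S₀.2
  obtain ⟨s₀⟩ := (inferInstance : Nonempty (F₀.obj (S₀.1 : 𝒢.V v₀)))
  refine ⟨F₀.map S₀.1.arrow s₀, fun i => ?_⟩
  -- the connected component `W` of `Z_M|_ℍ` through the level-`0` point
  let Φ₀ := (𝒢.restrict H).ρ ⟨v₀, hv₀⟩ ⋙ F₀
  let Z' := (𝒢.restrictFunctor H).obj (𝒢.twistedObj A b₀ T₁.1.arrow M)
  obtain ⟨W, m, z, hz, hWc, hWm⟩ := fiber_in_connected_component Φ₀ Z'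
    (F₀.map (S₀.1.arrow ≫ Sigma.ι (fun _ : ZMod M => A.S v₀) 0) s₀)
  -- `S₀ × {0} ⊆ W`
  have hS : ∃ g : (S₀.1 : 𝒢.V v₀) ⟶ W.S ⟨v₀, hv₀⟩, g ≫ m.fS ⟨v₀, hv₀⟩ =
      S₀.1.arrow ≫ Sigma.ι (fun _ : ZMod M => A.S v₀) 0 :=
    TwistedCovering.exists_lift_of_mono F₀ S₀.2 (m.fS ⟨v₀, hv₀⟩)
      ((𝒢.restrict H).mono_fS m ⟨v₀, hv₀⟩) _ s₀ z hz
  -- no twist on `T₂`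
  have tw₂ : ∀ (c : 𝒢.graph.Branch) (hc : 𝒢.graph.edgeOf c = 𝒢.graph.edgeOf b₀) (i : ZMod M),
      (hc ▸ T₂ : π₀Obj (A.T (𝒢.graph.edgeOf c))).1.arrow ≫
        Sigma.ι (fun _ : ZMod M => A.T (𝒢.graph.edgeOf c)) i ≫ (𝒢.twistFam A b₀ T₁.1.arrow M c).hom =
      (hc ▸ T₂ : π₀Obj (A.T (𝒢.graph.edgeOf c))).1.arrow ≫ Sigma.ι (fun _ : ZMod M => A.T _) (id i) := by
    intro c hc i
    by_cases hcb : c = b₀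
    · subst hcb
      rw [twistFam_self]
      exact TwistedCovering.arrow_ι_twistAut_hom_of_ne T₁ T₂ hT M i
    · rw [𝒢.twistFam_of_ne A b₀ T₁.1.arrow M hcb, Iso.refl_hom, Category.comp_id]
      rfl
  -- all levels of `S₀` lie in `W`
  obtain ⟨g, hg⟩ := 𝒢.levV_all A b₀ T₁ M H T₂ v₀ v₁ h₀ b₁ hb₁ hne h₁ x y hx hy hxv hyv S₀ S₁
    g₀ g₁ g₂ g₃ (tw₂ x hx) (tw₂ y hy)
    (fun v hv => W.S ⟨v, hv⟩) (fun v hv => m.fS ⟨v, hv⟩) (fun v hv => (𝒢.restrict H).mono_fS m ⟨v, hv⟩)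
    (fun e he => W.T ⟨e, he⟩) (fun e he => m.fT ⟨e, he⟩) (fun e he => (𝒢.restrict H).mono_fT m ⟨e, he⟩)
    (fun c v h hv hc => ⟨W.ψ ⟨c, hc⟩ ⟨v, hv⟩ ((SemiGraph.Subgraph.abuts_eq_some_iff H ⟨c, hc⟩ ⟨v, hv⟩).mpr h),
      m.comm ⟨c, hc⟩ ⟨v, hv⟩ _⟩)
    hv₀ hv₁ he hS i
  -- `W` is connected: `Π_ℍ` moves the level-`0` point to the level-`i` point
  obtain ⟨σ, hσ⟩ := MulAction.exists_smul_eq (Aut Φ₀) z (show Φ₀.obj W from F₀.map g s₀)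
  refine ⟨σ, ?_⟩
  have hnat := mulAction_naturality Φ₀ σ m z
  rw [hσ] at hnat
  have e1 : F₀.map (Sigma.ι (fun _ : ZMod M => A.S v₀) 0) (F₀.map S₀.1.arrow s₀) =
      Φ₀.map m z := by
    rw [← FintypeCat.comp_apply, ← F₀.map_comp]
    exact hz.symm
  have e2 : Φ₀.map m (F₀.map g s₀) =
      F₀.map (Sigma.ι (fun _ : ZMod M => A.S v₀) i) (F₀.map S₀.1.arrow s₀) := by
    have := congrArg (fun k => F₀.map k s₀) hg
    simp only [F₀.map_comp, FintypeCat.comp_apply] at this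
    exact this
  rw [e1]
  exact hnat.trans e2

end SemiGraphOfAnabelioids

end Literature.AnabelianGeometry.SemiGraphs
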